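import Literature.MathematicalPhysics.QuantumLattice.BdGBondHamiltonianParticleHole
import Literature.Probability.LatticeModels.IsingTorusTransfer
import HarnessLib

/-!
# Global `U(1)` phase rotations of the BdG Nambu matrix and the telescoping of gauge factors

Topic `Literature/MathematicalPhysics/QuantumLattice` (family `hubbard`), in the story of
`BdGBondHamiltonian(ParticleHole).lean`. A GLOBAL phase `e^{iθ}` of the pairing data is a unitary
conjugation of the Nambu matrix `𝓗 = bdgNambuMatrix τ Δ μ` by the diagonal one-body gauge rotation

  `nambuPhase θ = diag(e^{-iθ/2} on ↑-orbitals, e^{+iθ/2} on ↓-orbitals)`   (one definition),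

the one-body shadow of `e^{iθN/2}` after Lieb's partial particle–hole transformation:

* `bdgNambuMatrix_phase` — **`𝓗(τ, e^{iθ}Δ, μ) = u_θ 𝓗(τ, Δ, μ) u_θᴴ`**, `u_θ = nambuPhase θ`;
  `nambuPhase_mul_conjTranspose`, `nambuPhase_conjTranspose_mul` (unitarity), `nambuPhase_zero`,
  `conjTranspose_nambuPhase_mul_nambuPhase` (`u_θᴴ u_θ' = u_{θ'-θ}`);
* `gibbsWeight_conj_of_mul_eq_one` — `e^{-a u X v} = u e^{-aX} v` for a two-sided inverse pair;
* **telescoping** `prod_ofFn_conj_castSucc` / `prod_ofFn_conj_cyclic` /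
  `det_one_add_prod_ofFn_conj_cyclic`: for matrices `u_t, v_t` with `u_t v_t = v_t u_t = 1` and any
  `G_t`, `∏_t (u_t G_t v_t) = u_0 (∏_t G_t (v_t u_{t+1})) v_0` with `t + 1` taken CYCLICALLY in
  `Fin (m+1)`, hence `det(1 + ∏_t u_t G_t v_t) = det(1 + ∏_t G_t (v_t u_{t+1}))`;
* `det_one_add_prod_gibbsWeight_bdgNambuMatrix_phase` — the application: for a slice-constant
  (zero spatial mode) pair-phase history `θ_t`,
  `det(1 + ∏_t e^{-a𝓗(τ, e^{iθ_t}Δ, μ)}) = det(1 + ∏_t e^{-a𝓗(τ,Δ,μ)} u_{θ_{t+1} - θ_t})`: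
  only the phase JUMPS between consecutive slices enter (and they sum to zero around the circle).

With the Trotter determinant formula (`BdGBondHamiltonianTrotterDeterminant`) this is the
one-body form of `Tr ∏_t e^{-aH(e^{iθ_t}Δ)} = Tr ∏_t (e^{-aH} e^{iδ_t N/2})`.

## Mathlib / tree search

Tree (REUSED): `bdgNambuMatrix`, `bdgNambuMatrix_orb_orb`, `orb`, `ofLex_orb`, `Matrix.gibbsWeight`.
Tree: `Literature.Probability.LatticeModels.snoc_apply_succ_eq` (closing a sequence into a cycle,
`IsingTorusTransfer`). Mathlib / core: `Matrix.exp_conj`, `Matrix.det_one_add_mul_comm`,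
`List.ofFn_succ`, `Fin.snoc`, `Fin.lastCases`.

## References

* V. Bach, E. H. Lieb, J. P. Solovej, J. Stat. Phys. 76 (1994) 3, §2 (Nambu/particle–hole form).
  [BachLiebSolovej1994]
* P. G. de Gennes, *Superconductivity of Metals and Alloys* (1966), Ch. 5 (gauge covariance of
  the BdG equations). [deGennes1966]
-/

noncomputable section

namespace Literature.MathematicalPhysics.QuantumLattice

open Matrix Finset NormedSpace

variable {Λ : Type*} [LinearOrder Λ] [Fintype Λ]

/-! ### Scalar phase algebra -/

/-- `conj e^{ia} = e^{-ia}` for real `a`. [folklore] -/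
theorem star_cexp_ofReal_mul_I (a : ℝ) :
    star (Complex.exp ((a : ℂ) * Complex.I)) = Complex.exp (((-a : ℝ) : ℂ) * Complex.I) := by
  rw [Complex.star_def, ← Complex.exp_conj, map_mul, Complex.conj_ofReal, Complex.conj_I,
    Complex.ofReal_neg]
  ring_nf

/-- `e^{ia} conj(e^{ia}) = 1` for real `a`. [folklore] -/
theorem cexp_ofReal_mul_I_mul_star (a : ℝ) :
    Complex.exp ((a : ℂ) * Complex.I) * star (Complex.exp ((a : ℂ) * Complex.I)) = 1 := by
  rw [star_cexp_ofReal_mul_I, ← Complex.exp_add, Complex.ofReal_neg, neg_mul, add_neg_cancel,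
    Complex.exp_zero]

/-- `e^{ia} e^{ib} = e^{i(a+b)}` for real `a, b`. [folklore] -/
theorem cexp_ofReal_mul_I_mul (a b : ℝ) :
    Complex.exp ((a : ℂ) * Complex.I) * Complex.exp ((b : ℂ) * Complex.I) =
      Complex.exp (((a + b : ℝ) : ℂ) * Complex.I) := by
  rw [← Complex.exp_add, Complex.ofReal_add, add_mul]

/-! ### The one-body gauge rotation -/

/-- The diagonal one-body `U(1)` gauge rotation in Nambu space: `e^{-iθ/2}` on spin-`↑` (particle)
orbitals, `e^{+iθ/2}` on spin-`↓` (hole, after the partial particle–hole transformation) orbitals.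
de Gennes (1966) Ch. 5. [cite: deGennes1966, Ch. 5] -/
def nambuPhase (θ : ℝ) : Matrix (Orb Λ) (Orb Λ) ℂ :=
  diagonal fun o => if (ofLex o).2 = 0 then Complex.exp (((-(θ / 2) : ℝ) : ℂ) * Complex.I)
    else Complex.exp (((θ / 2 : ℝ) : ℂ) * Complex.I)

/-- `u_θ u_θᴴ = 1`. [folklore] -/
theorem nambuPhase_mul_conjTranspose (θ : ℝ) :
    nambuPhase (Λ := Λ) θ * (nambuPhase θ)ᴴ = 1 := by
  rw [nambuPhase, diagonal_conjTranspose, diagonal_mul_diagonal, ← diagonal_one]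
  congr 1
  funext o
  rw [Pi.star_apply]
  by_cases h : (ofLex o).2 = 0
  · rw [if_pos h]; exact cexp_ofReal_mul_I_mul_star _
  · rw [if_neg h]; exact cexp_ofReal_mul_I_mul_star _

/-- `u_θᴴ u_θ = 1`. [folklore] -/
theorem nambuPhase_conjTranspose_mul (θ : ℝ) :
    (nambuPhase (Λ := Λ) θ)ᴴ * nambuPhase θ = 1 := by
  rw [nambuPhase, diagonal_conjTranspose, diagonal_mul_diagonal, ← diagonal_one]
  congr 1
  funext o
  rw [Pi.star_apply, mul_comm]
  by_cases h : (ofLex o).2 = 0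
  · rw [if_pos h]; exact cexp_ofReal_mul_I_mul_star _
  · rw [if_neg h]; exact cexp_ofReal_mul_I_mul_star _

omit [Fintype Λ] in
/-- `u_0 = 1`. [folklore] -/
theorem nambuPhase_zero : nambuPhase (Λ := Λ) 0 = 1 := by
  rw [nambuPhase, ← diagonal_one]
  congr 1
  funext o
  split_ifs <;> simp

/-- `u_θᴴ u_θ' = u_{θ' - θ}`: consecutive gauge rotations compose to the rotation by the phase
JUMP. [folklore] -/
theorem conjTranspose_nambuPhase_mul_nambuPhase (θ θ' : ℝ) :
    (nambuPhase (Λ := Λ) θ)ᴴ * nambuPhase θ' = nambuPhase (θ' - θ) := by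
  rw [nambuPhase, nambuPhase, nambuPhase, diagonal_conjTranspose, diagonal_mul_diagonal]
  congr 1
  funext o
  rw [Pi.star_apply]
  by_cases h : (ofLex o).2 = 0
  · rw [if_pos h, if_pos h, if_pos h, star_cexp_ofReal_mul_I, cexp_ofReal_mul_I_mul]
    congr 3
    ring
  · rw [if_neg h, if_neg h, if_neg h, star_cexp_ofReal_mul_I, cexp_ofReal_mul_I_mul]
    congr 3
    ring

/-! ### Gauge covariance of the Nambu matrix -/

/-- **A global phase of the pairing data is a unitary conjugation of the Nambu matrix**:
`𝓗(τ, e^{iθ}Δ, μ) = u_θ 𝓗(τ, Δ, μ) u_θᴴ` (the `↓↑` block `-(Δ + Δᵀ)` picks up `e^{iθ}`, the `↑↓`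
block its conjugate, the diagonal blocks are untouched). de Gennes (1966) Ch. 5;
Bach–Lieb–Solovej 1994 §2. [cite: deGennes1966, Ch. 5] -/
theorem bdgNambuMatrix_phase (τ Δ : Λ → Λ → ℂ) (μ θ : ℝ) :
    bdgNambuMatrix τ (fun x y => Complex.exp (Complex.I * θ) * Δ x y) μ =
      nambuPhase θ * bdgNambuMatrix τ Δ μ * (nambuPhase θ)ᴴ := by
  -- the phase `e^{iθ}` and its conjugate in terms of the half-angle phases
  have hθ : Complex.exp (Complex.I * θ) =
      Complex.exp (((θ / 2 : ℝ) : ℂ) * Complex.I) * Complex.exp (((θ / 2 : ℝ) : ℂ) * Complex.I) := by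
    rw [cexp_ofReal_mul_I_mul, mul_comm Complex.I]
    congr 2
    push_cast
    ring
  have hθ' : star (Complex.exp (Complex.I * θ)) = Complex.exp (((-(θ / 2) : ℝ) : ℂ) * Complex.I) *
      Complex.exp (((-(θ / 2) : ℝ) : ℂ) * Complex.I) := by
    rw [hθ, star_mul', star_cexp_ofReal_mul_I]
  have hm : Complex.exp (((-(θ / 2) : ℝ) : ℂ) * Complex.I) *
      Complex.exp (((θ / 2 : ℝ) : ℂ) * Complex.I) = 1 := by
    rw [cexp_ofReal_mul_I_mul, neg_add_cancel, Complex.ofReal_zero, zero_mul, Complex.exp_zero]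
  ext o o'
  obtain ⟨⟨x, σ⟩, rfl⟩ : ∃ p : Λ × Fin 2, toLex p = o := ⟨ofLex o, rfl⟩
  obtain ⟨⟨y, σ'⟩, rfl⟩ : ∃ p : Λ × Fin 2, toLex p = o' := ⟨ofLex o', rfl⟩
  rw [nambuPhase, diagonal_conjTranspose, mul_diagonal, diagonal_mul, Pi.star_apply]
  change bdgNambuMatrix τ _ μ (orb x σ) (orb y σ') =
    _ * bdgNambuMatrix τ Δ μ (orb x σ) (orb y σ') * _
  rw [bdgNambuMatrix_orb_orb, bdgNambuMatrix_orb_orb, ofLex_orb, ofLex_orb]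
  dsimp only
  by_cases hσ : σ = 0 <;> by_cases hσ' : σ' = 0
  · simp only [if_pos hσ, if_pos hσ', star_cexp_ofReal_mul_I, neg_neg]
    linear_combination (τ x y - if x = y then (μ : ℂ) else 0) * hm.symm
  · simp only [if_pos hσ, if_neg hσ', ← mul_add, star_mul', hθ', star_cexp_ofReal_mul_I]
    ring
  · simp only [if_neg hσ, if_pos hσ', ← mul_add, hθ, star_cexp_ofReal_mul_I, neg_neg]
    ring
  · simp only [if_neg hσ, if_neg hσ', star_cexp_ofReal_mul_I]
    linear_combination (-τ y x + if x = y then (μ : ℂ) else 0) * ((mul_comm _ _).trans hm).symm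

/-- The Gibbs weight of a conjugate by a two-sided inverse pair `u v = v u = 1` is the conjugate of
the Gibbs weight. [folklore] -/
theorem gibbsWeight_conj_of_mul_eq_one {n : Type*} [Fintype n] [DecidableEq n]
    {u v : Matrix n n ℂ} (huv : u * v = 1) (a : ℝ) (X : Matrix n n ℂ) :
    Matrix.gibbsWeight a (u * X * v) = u * Matrix.gibbsWeight a X * v := by
  have hinv : u⁻¹ = v := Matrix.inv_eq_right_inv huv
  have hunit : IsUnit u :=
    (Matrix.isUnit_iff_isUnit_det u).mpr (Matrix.isUnit_det_of_right_inverse huv)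
  rw [Matrix.gibbsWeight, Matrix.gibbsWeight, ← hinv,
    show -(a : ℂ) • (u * X * u⁻¹) = u * (-(a : ℂ) • X) * u⁻¹ by rw [Matrix.mul_smul, Matrix.smul_mul],
    Matrix.exp_conj _ _ hunit]

/-! ### Telescoping of gauge factors through a product -/

/-- Telescoping, open-chain form: with `m + 1` conjugating pairs `u_s v_s = 1`,
`∏_{t<m} (u_t G_t v_t) = u_0 · ∏_{t<m} (G_t (v_t u_{t+1})) · v_m`. [folklore] -/
theorem prod_ofFn_conj_castSucc {n : Type*} [Fintype n] [DecidableEq n] :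
    ∀ {m : ℕ} (u v : Fin (m + 1) → Matrix n n ℂ) (_huv : ∀ s, u s * v s = 1)
      (G : Fin m → Matrix n n ℂ),
      (List.ofFn fun t : Fin m => u t.castSucc * G t * v t.castSucc).prod =
        u 0 * (List.ofFn fun t : Fin m => G t * (v t.castSucc * u t.succ)).prod * v (Fin.last m)
  | 0, u, v, huv, G => by
    rw [List.ofFn_zero, List.ofFn_zero, List.prod_nil, Matrix.mul_one]
    exact (huv 0).symm
  | m + 1, u, v, huv, G => by
    have ih := prod_ofFn_conj_castSucc (fun s => u s.succ) (fun s => v s.succ) (fun s => huv s.succ)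
      (fun t => G t.succ)
    rw [List.ofFn_succ, List.prod_cons, List.ofFn_succ, List.prod_cons, Fin.castSucc_zero]
    simp only [Fin.succ_castSucc] at ih
    rw [ih, Fin.succ_last]
    simp only [Matrix.mul_assoc]

/-- **Telescoping, cyclic form**: with conjugating pairs `u_t v_t = 1` (`t : Fin (m+1)`),
`∏_t (u_t G_t v_t) = u_0 · ∏_t (G_t (v_t u_{t+1})) · v_0`, the index `t + 1` taken modulo
`m + 1`. [folklore] -/
theorem prod_ofFn_conj_cyclic {n : Type*} [Fintype n] [DecidableEq n] {m : ℕ}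
    (u v : Fin (m + 1) → Matrix n n ℂ) (huv : ∀ t, u t * v t = 1) (G : Fin (m + 1) → Matrix n n ℂ) :
    (List.ofFn fun t => u t * G t * v t).prod =
      u 0 * (List.ofFn fun t => G t * (v t * u (t + 1))).prod * v 0 := by
  have hpair : ∀ s : Fin (m + 2),
      (Fin.snoc u (u 0) : Fin (m + 2) → Matrix n n ℂ) s * (Fin.snoc v (v 0) : Fin (m + 2) → _) s = 1 := by
    intro s
    induction s using Fin.lastCases with
    | last => rw [Fin.snoc_last, Fin.snoc_last]; exact huv 0
    | cast i => rw [Fin.snoc_castSucc, Fin.snoc_castSucc]; exact huv i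
  have h := prod_ofFn_conj_castSucc (Fin.snoc u (u 0)) (Fin.snoc v (v 0)) hpair G
  simp only [Fin.snoc_castSucc, Literature.Probability.LatticeModels.snoc_apply_succ_eq,
    Fin.snoc_last] at h
  have h0 : (Fin.snoc u (u 0) : Fin (m + 2) → Matrix n n ℂ) 0 = u 0 :=
    Fin.snoc_castSucc (α := fun _ => Matrix n n ℂ) (x := u 0) (p := u) 0
  rw [h, h0]

/-- **The determinant of `1 + ` a cyclically gauge-conjugated product only sees the jumps**:
`det(1 + ∏_t u_t G_t v_t) = det(1 + ∏_t G_t (v_t u_{t+1}))` for two-sided inverse pairs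
`u_t v_t = v_t u_t = 1` (cyclic `t + 1`). [folklore] -/
theorem det_one_add_prod_ofFn_conj_cyclic {n : Type*} [Fintype n] [DecidableEq n] {m : ℕ}
    (u v : Fin (m + 1) → Matrix n n ℂ) (huv : ∀ t, u t * v t = 1) (hvu : ∀ t, v t * u t = 1)
    (G : Fin (m + 1) → Matrix n n ℂ) :
    (1 + (List.ofFn fun t => u t * G t * v t).prod).det =
      (1 + (List.ofFn fun t => G t * (v t * u (t + 1))).prod).det := by
  rw [prod_ofFn_conj_cyclic u v huv G, Matrix.mul_assoc, det_one_add_mul_comm, Matrix.mul_assoc,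
    hvu 0, Matrix.mul_one]

/-! ### Application: a slice-constant pair-phase history -/

/-- **Only the phase jumps enter the Trotter determinant of a zero-mode phase history**:
`det(1 + ∏_t e^{-a𝓗(τ, e^{iθ_t}Δ, μ)}) = det(1 + ∏_t e^{-a𝓗(τ, Δ, μ)} u_{θ_{t+1} - θ_t})`
(`t + 1` cyclic in `Fin (m+1)`; `u = nambuPhase`). de Gennes (1966) Ch. 5 (gauge covariance).
[cite: deGennes1966, Ch. 5] -/
theorem det_one_add_prod_gibbsWeight_bdgNambuMatrix_phase {m : ℕ} (τ Δ : Λ → Λ → ℂ) (μ a : ℝ)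
    (θ : Fin (m + 1) → ℝ) :
    (1 + (List.ofFn fun t => Matrix.gibbsWeight a
        (bdgNambuMatrix τ (fun x y => Complex.exp (Complex.I * θ t) * Δ x y) μ)).prod).det =
      (1 + (List.ofFn fun t => Matrix.gibbsWeight a (bdgNambuMatrix τ Δ μ) *
        nambuPhase (θ (t + 1) - θ t)).prod).det := by
  have h : (fun t => Matrix.gibbsWeight a
      (bdgNambuMatrix τ (fun x y => Complex.exp (Complex.I * θ t) * Δ x y) μ)) =
      fun t => nambuPhase (θ t) * Matrix.gibbsWeight a (bdgNambuMatrix τ Δ μ) *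
        (nambuPhase (θ t))ᴴ := by
    funext t
    rw [bdgNambuMatrix_phase, gibbsWeight_conj_of_mul_eq_one (nambuPhase_mul_conjTranspose _)]
  have h2 : (fun t => Matrix.gibbsWeight a (bdgNambuMatrix τ Δ μ) *
      ((nambuPhase (Λ := Λ) (θ t))ᴴ * nambuPhase (θ (t + 1)))) =
      fun t => Matrix.gibbsWeight a (bdgNambuMatrix τ Δ μ) * nambuPhase (θ (t + 1) - θ t) := by
    funext t
    rw [conjTranspose_nambuPhase_mul_nambuPhase]
  rw [h, det_one_add_prod_ofFn_conj_cyclic _ _ (fun t => nambuPhase_mul_conjTranspose _)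
    (fun t => nambuPhase_conjTranspose_mul _), h2]

end Literature.MathematicalPhysics.QuantumLattice
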